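import Literature.ComputerArithmetic.SaoEtAl2026.ReductionTrees
import Summits.Ventures.CertifiedArithmetic.LowPrec.SRTreeExtremal
import HarnessLib

/-!
# Discharging the Λ₁-extrema named facts of Sao et al. (Prop. 3.1) and the Λ₂ companion

HONEST FRAMING: certified error envelopes and provably optimal rounding/accumulation schemes for
low-precision formats under stated cost models; every table by two implementations; no hardware
or vendor claims.

`Literature.ComputerArithmetic.SaoEtAl2026.ReductionTrees` types the tree-shape statistics
`Λ₁, Λ₂` of [cite: SaoEtAl2026] (Cor. 2.5) and their Prop. 3.1 (Λ₁-extrema) as the named facts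
`Shape.Lambda1Extrema`, `Shape.Lambda1ExtremaAttained`.  Here both are PROVED (no hypotheses),
by transporting a shape to a summation tree `STree Unit` (`ofShape`; `Λ₁ = SR.epl`,
`Λ₂ = SR.sizeSq`) and invoking `SRTreeExtremal.lean` / `SRTreeDesign.lean`.  The same transport
gives the `Λ₂` statement that is NOT in the source (which optimises `Λ₂` only inside blocked /
fixed-stage families and lists the combined optimisation as open, §8.2): over all full binary
trees with `k` leaves the halving tree minimises and the sequential tree maximises `Λ₂`
(`shape_lambda2_extrema`).
-/

namespace Summit.Ventures.CertifiedArithmetic.LowPrec.SR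

open Literature.ComputerArithmetic.SaoEtAl2026

/-- Transport: a tree shape as a summation tree with unit labels. -/
def ofShape : Shape → STree Unit
  | .leaf => .leaf ()
  | .node l r => .node (ofShape l) (ofShape r)

/-- `ofShape` preserves the number of leaves. -/
theorem leaves_ofShape : ∀ T : Shape, (ofShape T).leaves = T.size
  | .leaf => rfl
  | .node l r => by simp [ofShape, STree.leaves, Shape.size, leaves_ofShape l, leaves_ofShape r]

/-- `Λ₁` is the external path length `SR.epl`. -/
theorem epl_ofShape : ∀ T : Shape, epl (ofShape T) = T.lambda1
  | .leaf => rfl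
  | .node l r => by
      simp [ofShape, epl, Shape.lambda1, epl_ofShape l, epl_ofShape r, leaves_ofShape]

/-- `Λ₂` is `SR.sizeSq`. -/
theorem sizeSq_ofShape : ∀ T : Shape, sizeSq (ofShape T) = T.lambda2
  | .leaf => rfl
  | .node l r => by
      simp only [ofShape, sizeSq, Shape.lambda2, sizeSq_ofShape l, sizeSq_ofShape r, leaves_ofShape]
      ring

/-- The halving shape is the pairwise summation tree. -/
theorem ofShape_halving : ∀ (n o : ℕ), ofShape (Shape.halving n) = pairwise (fun _ => ()) o n := by
  intro n
  induction n using Nat.strong_induction_on with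
  | _ n ih =>
    intro o
    rcases Nat.lt_or_ge n 2 with h | h
    · interval_cases n <;> simp [Shape.halving, pairwise, ofShape]
    · obtain ⟨m, rfl⟩ : ∃ m, n = m + 2 := ⟨n - 2, by omega⟩
      rw [Shape.halving, pairwise, ofShape, ih ((m + 2) / 2) (by omega),
        ih ((m + 3) / 2) (by omega)]

/-- The closed form of `optEpl` at `L = ⌊log₂ n⌋`: `optEpl n = n⌊log₂ n⌋ + 2(n − 2^⌊log₂ n⌋)`
(`n ≥ 1`), the `Λ₁^min` formula of [cite: SaoEtAl2026, Prop. 3.1]. -/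
theorem optEpl_eq_log {n : ℕ} (hn : 1 ≤ n) :
    optEpl n = n * Nat.log 2 n + 2 * (n - 2 ^ Nat.log 2 n) := by
  set L := Nat.log 2 n
  have h1 : 2 ^ L ≤ n := Nat.pow_log_le_self 2 (by omega)
  have h2 : n < 2 ^ (L + 1) := Nat.lt_pow_succ_log_self (by norm_num) n
  have h := optEpl_closed L n h1 h2.le
  have e : 2 ^ (L + 1) = 2 * 2 ^ L := by ring
  rw [e] at h
  have : n * (L + 2) = n * L + 2 * n := by ring
  omega

/-- **Prop. 3.1 of Sao et al., the bounds — PROVED.** Every full binary tree with `k` leaves has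
`k⌊log₂ k⌋ + 2(k − 2^⌊log₂ k⌋) ≤ Λ₁ ≤ k(k+1)/2 − 1`. Discharges the named fact. -/
theorem lambda1Extrema_holds : Shape.Lambda1Extrema := by
  intro T
  have h1 := optEpl_le_epl (ofShape T)
  have h2 := two_mul_epl_le (ofShape T)
  rw [leaves_ofShape, epl_ofShape] at h1 h2
  exact ⟨(optEpl_eq_log (Shape.size_pos T)) ▸ h1, h2⟩

/-- **Prop. 3.1 of Sao et al., attainment — PROVED.** The halving tree on `k ≥ 1` leaves has `k`
leaves and `Λ₁ = k⌊log₂ k⌋ + 2(k − 2^⌊log₂ k⌋)`; the sequential tree has `2Λ₁ + 2 = k(k+1)`.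
Discharges the named fact. -/
theorem lambda1ExtremaAttained_holds : Shape.Lambda1ExtremaAttained := by
  intro k hk
  have hs : (Shape.halving k).size = k := by
    rw [← leaves_ofShape, ofShape_halving k 0, leaves_pairwise _ _ _ hk]
  refine ⟨hs, ?_, Shape.lambda1ExtremaAttained_sequential hk⟩
  rw [← epl_ofShape, ofShape_halving k 0, epl_pairwise _ _ _ hk, optEpl_eq_log hk]

/-- For every shape, the halving tree on the same number of leaves has the least `Λ₁`. -/
theorem shape_lambda1_halving_le (T : Shape) : (Shape.halving T.size).lambda1 ≤ T.lambda1 := by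
  rw [← epl_ofShape, ← epl_ofShape T, ofShape_halving _ 0, ← leaves_ofShape]
  exact epl_pairwise_le _ 0 _

/-- **The `Λ₂` companion of Prop. 3.1 (ours, not in the source).** Over all full binary trees with
`k` leaves: the halving tree minimises `Λ₂` (value `optSq k ≤ 2k² − k − 1`, `SRTreeDesign`) and the
sequential tree maximises it (`6Λ₂ + 6 ≤ k(k+1)(2k+1)`, attained: `Shape.lambda2_sequential`). -/
theorem shape_lambda2_extrema (T : Shape) :
    (Shape.halving T.size).lambda2 ≤ T.lambda2 ∧ (Shape.halving T.size).lambda2 = optSq T.size ∧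
      6 * T.lambda2 + 6 ≤ T.size * (T.size + 1) * (2 * T.size + 1) := by
  refine ⟨?_, ?_, ?_⟩
  · rw [← sizeSq_ofShape, ← sizeSq_ofShape T, ofShape_halving _ 0, ← leaves_ofShape]
    exact sizeSq_pairwise_le _ 0 _
  · rw [← sizeSq_ofShape, ofShape_halving _ 0, sizeSq_pairwise _ _ _ (Shape.size_pos T)]
  · have h := six_mul_sizeSq_le (ofShape T)
    rwa [leaves_ofShape, sizeSq_ofShape] at h

/-- Both statistics at once: for i.i.d. inputs (cost `τ²Λ₁ + μ²Λ₂`, [cite: SaoEtAl2026, Cor. 2.5])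
the halving tree is simultaneously `Λ₁`- and `Λ₂`-optimal among all full binary trees with the same
number of leaves, whatever `τ², μ²` — so in the i.i.d. compression there is no trade-off to
resolve. -/
theorem shape_halving_optimal (T : Shape) (τ2 μ2 : ℕ) :
    τ2 * (Shape.halving T.size).lambda1 + μ2 * (Shape.halving T.size).lambda2 ≤
      τ2 * T.lambda1 + μ2 * T.lambda2 :=
  Nat.add_le_add (Nat.mul_le_mul_left _ (shape_lambda1_halving_le T))
    (Nat.mul_le_mul_left _ (shape_lambda2_extrema T).1)

end Summit.Ventures.CertifiedArithmetic.LowPrec.SR
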